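import Literature.AlgebraicGeometry.HodgeTheory.RegularImmersionConormal
import HarnessLib

/-!
# The conormal frame of a regular immersion is given by the pulled-back generators (explicit form of GW II Rem. 19.22)

Topic `Literature/AlgebraicGeometry/HodgeTheory` (companion of `RegularImmersionConormal.lean`). THEOREMS ONLY (no definition, no named
fact, no `sorry`). For a closed immersion `i : Z ⟶ X` into a locally Noetherian scheme, an affine open `V ⊆ X` and a weakly regular sequence
`x = (x_1, …, x_n)` of sections generating the kernel ideal `𝓘(V)`: `nonempty_basis_sections_pullback_idealModule` (that file) gives SOME basis
of the `Γ(i⁻¹V, 𝒪_Z)`-module `Γ(i⁻¹V, i^*𝓘)` indexed by `Fin n`; here we record the EXPLICIT form used by consumers that read transition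
matrices (crux chain w45b, T-DIRLIFT-UP route C): there are sections `s_j ∈ Γ(V, 𝓘)` reading to `x_j` and a basis `b` with
`b_j = η(s_j)|_{i⁻¹V}` — «the images `f̄_i` of the `f_i` in `𝓘/𝓘² = 𝒞_i` form a basis» (GW II Rem. 19.22, verbatim). Proof: the
`η(s_j)` SPAN (every section of `i^*𝓘` over the affine `i⁻¹V` is a `Γ(i⁻¹V)`-combination of unit sections `η(m)`, `m ∈ Γ(V, 𝓘) = Σ A s_j`,
by the affine chart `Γ(i⁻¹V, i^*𝓘) ≅ B ⊗_A Γ(V, 𝓘)`), and `n` spanning elements of a module free of rank `n` over a commutative ring form a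
basis (a surjective endomorphism of a finite module is injective, Vasconcelos / Mathlib `OrzechProperty`).

References: U. Görtz, T. Wedhorn, *Algebraic Geometry II* (2023), Rem. 19.22 / Def. 19.21 (b); W. Vasconcelos, *On finitely generated flat
modules*, Trans. AMS 138 (1969) (surjective endomorphisms) — through Mathlib `Module.Finite.injective_of_surjective_endomorphism`.
-/

noncomputable section

open CategoryTheory CategoryTheory.Limits AlgebraicGeometry Opposite TopologicalSpace
open Literature.AlgebraicGeometry.Modules Literature.AlgebraicGeometry.Morphisms
open Literature.AlgebraicGeometry.Deformation Literature.AlgebraicGeometry.Motives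

namespace Literature.AlgebraicGeometry.HodgeTheory

universe u

/-- Transport of submodule membership along an equality of elements. [folklore] -/
private theorem mem_of_eq_of_mem'' {R M : Type*} [Semiring R] [AddCommMonoid M] [Module R M]
    {S : Submodule R M} {a b : M} (h : a = b) (hb : b ∈ S) : a ∈ S := h ▸ hb

variable {X Z : Scheme.{u}} (i : Z ⟶ X)

set_option maxRecDepth 4000 in -- the change-of-rings instance chain of the affine chart is deep (as in the parent file)
/-- **Explicit conormal frame (GW II Rem. 19.22).** For a closed immersion `i : Z ⟶ X`, `X` locally Noetherian, an affine open `V` and a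
weakly regular sequence `x : Fin n → Γ(X, V)` generating `𝓘(V) = ker(Γ(V, 𝒪_X) → Γ(i⁻¹V, 𝒪_Z))`: there are sections `s_j ∈ Γ(V, 𝓘)` of the
ideal module reading to the `x_j`, and a basis `b` of `Γ(i⁻¹V, i^*𝓘)` over `Γ(i⁻¹V, 𝒪_Z)` whose vectors ARE the pulled-back sections
`η(s_j)|_{i⁻¹V}`. [cite: GortzWedhorn2023, Rem. 19.22 and Def. 19.21 (b)] -/
theorem exists_basis_sections_pullback_idealModule_eq [IsLocallyNoetherian X] [IsClosedImmersion i]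
    (V : X.affineOpens) {n : ℕ} (x : Fin n → Γ(X, (V : X.Opens)))
    (hreg : RingTheory.Sequence.IsWeaklyRegular Γ(X, (V : X.Opens)) (List.ofFn x))
    (hI : Ideal.span (Set.range x) = i.ker.ideal V) :
    ∃ (s : Fin n → Γ(idealModule i, (V : X.Opens)))
      (b : Module.Basis (Fin n) Γ(Z, i ⁻¹ᵁ (V : X.Opens))
        Γ((Scheme.Modules.pullback i).obj (idealModule i), i ⁻¹ᵁ (V : X.Opens))),
      (∀ j, toRing (idealModuleι i) (V : X.Opens) (s j) = x j) ∧
      ∀ j, b j = unitSectionLE i (idealModule i) (le_refl (i ⁻¹ᵁ (V : X.Opens))) (s j) := by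
  classical
  haveI : IsLocallyNoetherian Z := LocallyOfFiniteType.isLocallyNoetherian i
  have hV : IsAffineOpen (V : X.Opens) := V.2
  have hU : IsAffineOpen (i ⁻¹ᵁ (V : X.Opens)) := hV.preimage i
  have le : i ⁻¹ᵁ (V : X.Opens) ≤ i ⁻¹ᵁ (V : X.Opens) := le_rfl
  set M : X.Modules := idealModule i with hMdef
  have hM : IsAffineLocalizing M := (coh_idealModule i).loc
  set φ : Γ(X, (V : X.Opens)) →+* Γ(Z, i ⁻¹ᵁ (V : X.Opens)) := (i.app (V : X.Opens)).hom with hφ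
  have hφsurj : Function.Surjective φ := i.app_surjective (V : X.Opens) hV
  have hker : i.ker.ideal V = RingHom.ker φ := Scheme.Hom.ker_apply i V
  have happLE : ∀ r, i.appLE (V : X.Opens) (i ⁻¹ᵁ (V : X.Opens)) le r = φ r := fun r ↦ by
    rw [Scheme.Hom.appLE_eq_app]
  -- the reading `ρ : Γ(V, 𝓘) → A` of sections of the ideal module (injective, `A`-linear)
  let ρ : Γ(M, (V : X.Opens)) → Γ(X, (V : X.Opens)) := toRing (idealModuleι i) (V : X.Opens)
  have hρinj : Function.Injective ρ := kernel_ι_app_injective (structureModuleMap i) (V : X.Opens)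
  have hρsum : ∀ (a : Fin n → Γ(X, (V : X.Opens))) (t : Fin n → Γ(M, (V : X.Opens))),
      ρ (∑ j, a j • t j) = ∑ j, a j * ρ (t j) := by
    intro a t
    change ((idealModuleι i).app (V : X.Opens)).hom (∑ j, a j • t j) = _
    rw [map_sum]
    exact Finset.sum_congr rfl fun j _ ↦ toRing_smul (idealModuleι i) (V : X.Opens) (a j) (t j)
  -- sections `s j ∈ Γ(V, 𝓘)` reading to the generators `x j`
  have hx0 : ∀ j, (structureModuleMap i).app (V : X.Opens) (x j) = 0 := by
    intro j
    have hj : x j ∈ RingHom.ker φ := by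
      rw [← hker, ← hI]
      exact Ideal.subset_span ⟨j, rfl⟩
    exact hj
  choose s hs using fun j ↦ exists_kernel_ι_app_eq (structureModuleMap i) (V : X.Opens) (x j) (hx0 j)
  have hρs : ∀ j, ρ (s j) = x j := hs
  -- `Γ(V, 𝓘)` is generated by the `s j`
  have hgen : ∀ m : Γ(M, (V : X.Opens)), ∃ a : Fin n → Γ(X, (V : X.Opens)), m = ∑ j, a j • s j := by
    intro m
    have hm : ρ m ∈ Ideal.span (Set.range x) := by
      rw [hI, hker]
      exact app_idealModuleι_eq_zero i (V : X.Opens) m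
    obtain ⟨a, ha⟩ := Ideal.mem_span_range_iff_exists_fun.1 hm
    refine ⟨a, hρinj ?_⟩
    rw [hρsum, ← ha]
    exact Finset.sum_congr rfl fun j _ ↦ by rw [hρs]
  -- the candidate basis: the pulled-back generators
  let b : Fin n → Γ((Scheme.Modules.pullback i).obj M, i ⁻¹ᵁ (V : X.Opens)) :=
    fun j ↦ unitSectionLE i M le (s j)
  let η : Γ(M, (V : X.Opens)) →+ Γ((Scheme.Modules.pullback i).obj M, i ⁻¹ᵁ (V : X.Opens)) :=
    { toFun := unitSectionLE i M le
      map_zero' := by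
        have h := unitSectionLE_add i M le (0 : Γ(M, (V : X.Opens))) 0
        rw [add_zero] at h
        exact left_eq_add.mp h
      map_add' := unitSectionLE_add i M le }
  have hηsum : ∀ a : Fin n → Γ(X, (V : X.Opens)),
      unitSectionLE i M le (∑ j, a j • s j) = ∑ j, φ (a j) • b j := by
    intro a
    change η (∑ j, a j • s j) = _
    rw [map_sum]
    refine Finset.sum_congr rfl fun j _ ↦ ?_
    change unitSectionLE i M le (a j • s j) = _
    rw [unitSectionLE_smul, happLE]
  let q := appTopRestrictFromSpecEquiv M hV
  -- (1) spanning over `B` (the affine chart `Γ(i⁻¹V, i^*𝓘) ≅ B ⊗_A Γ(V, 𝓘)` is generated by the `1 ⊗ m`)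
  have hsp : ⊤ ≤ Submodule.span Γ(Z, i ⁻¹ᵁ (V : X.Opens)) (Set.range b) := by
    rintro y -
    obtain ⟨t, rfl⟩ := (chartSectionsEquiv i M hV hU le hM).surjective y
    induction t using TensorProduct.induction_on with
    | zero =>
      exact mem_of_eq_of_mem'' (AddEquiv.map_zero (chartSectionsEquiv i M hV hU le hM))
        (Submodule.zero_mem _)
    | tmul c q' =>
      obtain ⟨m, rfl⟩ := q.surjective q'
      obtain ⟨a, rfl⟩ := hgen m
      have e2 : chartSectionsEquiv i M hV hU le hM
          ((show (ModuleCat.restrictScalars (chartHom i le).hom).obj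
              (ModuleCat.of _ Γ(Z, i ⁻¹ᵁ (V : X.Opens))) from (1 : Γ(Z, i ⁻¹ᵁ (V : X.Opens))))
              ⊗ₜ[Γ(X, (V : X.Opens))]
            (q (∑ j, a j • s j) : restrictTop M hV)) = unitSectionLE i M le (∑ j, a j • s j) :=
        chartSectionsEquiv_one_tmul i M hV hU le hM (∑ j, a j • s j)
      have hc1 := ModuleCat.ExtendScalars.smul_tmul (chartHom i le).hom (M := restrictTop M hV)
        (show Γ(Z, i ⁻¹ᵁ (V : X.Opens)) from c) 1 (q (∑ j, a j • s j) : restrictTop M hV)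
      rw [mul_one] at hc1
      have e1 := chartSectionsEquiv_smul i M hV hU le hM (show Γ(Z, i ⁻¹ᵁ (V : X.Opens)) from c)
        ((show (ModuleCat.restrictScalars (chartHom i le).hom).obj
              (ModuleCat.of _ Γ(Z, i ⁻¹ᵁ (V : X.Opens))) from (1 : Γ(Z, i ⁻¹ᵁ (V : X.Opens))))
              ⊗ₜ[Γ(X, (V : X.Opens))]
            (q (∑ j, a j • s j) : restrictTop M hV))
      have hval : chartSectionsEquiv i M hV hU le hM
          (c ⊗ₜ[Γ(X, (V : X.Opens))] (q (∑ j, a j • s j) : restrictTop M hV)) =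
          (show Γ(Z, i ⁻¹ᵁ (V : X.Opens)) from c) • ∑ j, φ (a j) • b j := by
        rw [← hηsum, ← e2, ← e1]
        exact congrArg _ hc1.symm
      refine mem_of_eq_of_mem'' hval (Submodule.smul_mem _ _ (Submodule.sum_mem _ fun j _ ↦ ?_))
      exact Submodule.smul_mem _ _ (Submodule.subset_span ⟨j, rfl⟩)
    | add t₁ t₂ h₁ h₂ =>
      exact mem_of_eq_of_mem'' (AddEquiv.map_add (chartSectionsEquiv i M hV hU le hM) t₁ t₂)
        (Submodule.add_mem _ h₁ h₂)
  -- (2) linear independence by counting: `n` spanning elements of a module free of rank `n`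
  obtain ⟨b₀⟩ := nonempty_basis_sections_pullback_idealModule i V x hreg hI
  have hli : LinearIndependent Γ(Z, i ⁻¹ᵁ (V : X.Opens)) b := by
    rw [linearIndependent_iff_injective_fintypeLinearCombination]
    -- the endomorphism `Bⁿ → Γ → Bⁿ` (combination, then coordinates in `b₀`) is onto, hence injective
    set f := Fintype.linearCombination Γ(Z, i ⁻¹ᵁ (V : X.Opens)) b with hf
    have hfsurj : Function.Surjective f := by
      rw [← LinearMap.range_eq_top, hf, Fintype.range_linearCombination]
      exact top_le_iff.mp hsp
    have hE : Function.Injective (b₀.equivFun.toLinearMap ∘ₗ f) :=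
      OrzechProperty.injective_of_surjective_endomorphism _ (b₀.equivFun.surjective.comp hfsurj)
    exact fun c c' h => hE (by change b₀.equivFun (f c) = b₀.equivFun (f c'); rw [h])
  refine ⟨s, Module.Basis.mk hli hsp, hρs, fun j => ?_⟩
  rw [Module.Basis.mk_apply]

end Literature.AlgebraicGeometry.HodgeTheory

end
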